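import Mathlib
import Literature.NumberTheory.LFunctions.Zhang2022.RepairBedUaSignModel
import HarnessLib

/-!
# Zhang (2022), rescue bed (D-0124 (3)) node D130-4 «U-a sign», MODEL side II: the `H¹`-type sizes of the registered
# pieces (`N₁(u_T) = √(4/3)`, `N_θ(v_J) = √(h³/3 + h)`, `N_θ(φ_θ) = √(h⁵/30 + h³/3)`) and the CURRENCY WINDOWS of the
# two typed certificates at the registered cells — `C* = sup RobustMargin` where the X = 0 design closes,
# `C_req = sup StrengthBelowReq` where it does not (bed-7 spec `bed7-Ua-sign-v0.1` §2, `OffDiagBoundedOn` currency)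

Topic `Literature/NumberTheory/LFunctions/Zhang2022` (Landau–Siegel audit tree; verdict-neutral).
Y. Zhang, *Discrete mean estimates and the Landau–Siegel zero*, arXiv:2211.02515v1 (2022) [Zhang2022LandauSiegel] —
**an unrefereed manuscript under adjudication; nothing here asserts or denies any of its claims, and nothing here is
a claim about Landau–Siegel zeros.**

Companion of `RepairBedUaSignModel` (atoms `𝔅(u_T) = 8/π + 52π/3`, `|c₀|²`, the X = 0 closing criterion and the
sign table). `KnifeEdgeOffDiagForm.RobustMargin θ C u u′ v v′` is the elementary inequality
`[(k₀ + 2C·n_θ²)·𝔅(u) < (|c₀| − C·n₁n_θ)² ∧ C·n₁n_θ ≤ |c₀|] ∨ [k₀ + 2C·n_θ² < 0]` under which the design closes against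
EVERY off-diagonal input `C`-bounded at the design (`exists_neg_of_robustMargin`); `StrengthBelowReq θ C` is
`2C·n_θ² ≤ k₀ ∧ (|c₀| + C·n₁n_θ)² ≤ (k₀ − 2C·n_θ²)·𝔅(u)`, under which NO `C`-bounded input closes it
(`twoPieceMainTerm_nonneg_of_strengthBelowReq`). Both are monotone in `C`, so `C*(d) = sup{C : RobustMargin}` and
`C_req(d) = sup{C : StrengthBelowReq}` are located by one holds/fails pair each. This file records

* `inClassNorm_taperProfile` (`N₁(u_T) = √(4/3)`), `overhangNorm_jumpProfile` (`√(h³/3 + h)`), `overhangNorm_phiT`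
  (`√(h⁵/30 + h³/3)`), with the underlying integrals;
* the windows (bed-7's printed currencies, now kernel facts; twenty-digit `π` and six-decimal rational windows on the
  atoms): **`C*(u_T ⊕ v_J, 2) ∈ (1.95, 1.96)`**, **`C*(u_T ⊕ v_J, 3) ∈ (22.46, 22.47)`**, **`C*(u_T ⊕ φ_3, 3) ∈ (9.17, 9.18)`**
  (`robustMargin_window_*`: `RobustMargin θ C` at the lower end, `¬ RobustMargin θ C` at the upper end);
  **`C_req(u_T ⊕ v_J, 5/4) ∈ (2.03, 2.04)`**, **`(v_J, 3/2) ∈ (2.43, 2.44)`**, **`(φ, 5/4) ∈ (1.75, 1.76)`**,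
  **`(φ, 3/2) ∈ (2.52, 2.53)`**, **`(φ, 2) ∈ (2.01, 2.02)`** (`strengthBelowReq_window_*`).

Reading (bed-7 §2, GAP G-12/G-23 C2): at the cells where the continued calculus closes, the genuine cross-slot
strengths `Ĉ_uv` the bed measured exceed these `C*` by factors 4–25; the windows say nothing about any genuine block.
Caveat as in the kit: `M_θ`, `θ > 1`, is formula I's calculus CONTINUED past `P`, not a proved main term. Theorems
only; no `instance`, no notation.

## References

* Y. Zhang, arXiv:2211.02515v1 (2022), §7 Prop 7.1, (7.2) p.44; §8 (8.11)–(8.12). [cite: Zhang2022LandauSiegel, §§7, 8]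
-/

noncomputable section

open Complex Real ComplexConjugate Set intervalIntegral
open _root_.MeasureTheory

namespace Literature.NumberTheory.LFunctions.Zhang2022.Repair.Bed

open KnifeEdge

/-! ### Part 1 — the `H¹`-type sizes of the registered pieces -/

section Sizes

variable {θ : ℝ}

/-- `∫ₐᵇ (c₄u⁴ + c₃u³ + c₂u² + c₁u + c₀) du` by the fundamental theorem of calculus. [folklore] -/
private theorem integral_quartic (c4 c3 c2 c1 c0 a b : ℝ) :
    ∫ u in a..b, (c4 * u ^ 4 + c3 * u ^ 3 + c2 * u ^ 2 + c1 * u + c0)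
      = (c4 * b ^ 5 / 5 + c3 * b ^ 4 / 4 + c2 * b ^ 3 / 3 + c1 * b ^ 2 / 2 + c0 * b)
        - (c4 * a ^ 5 / 5 + c3 * a ^ 4 / 4 + c2 * a ^ 3 / 3 + c1 * a ^ 2 / 2 + c0 * a) := by
  have hG : ∀ u : ℝ, HasDerivAt
      (fun u : ℝ => c4 * u ^ 5 / 5 + c3 * u ^ 4 / 4 + c2 * u ^ 3 / 3 + c1 * u ^ 2 / 2 + c0 * u)
      (c4 * u ^ 4 + c3 * u ^ 3 + c2 * u ^ 2 + c1 * u + c0) u := by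
    intro u
    have h5 := ((hasDerivAt_pow 5 u).const_mul c4).div_const 5
    have h4 := ((hasDerivAt_pow 4 u).const_mul c3).div_const 4
    have h3 := ((hasDerivAt_pow 3 u).const_mul c2).div_const 3
    have h2 := ((hasDerivAt_pow 2 u).const_mul c1).div_const 2
    have h1 := (hasDerivAt_id' u).const_mul c0
    refine ((((h5.add h4).add h3).add h2).add h1).congr_deriv ?_
    push_cast
    ring
  rw [intervalIntegral.integral_eq_sub_of_hasDerivAt (fun u _ => hG u)
    (Continuous.intervalIntegrable (by fun_prop) _ _)]

/-- `∫₀¹ (|u_T|² + |u_T′|²) = 4/3`. [cite: Zhang2022LandauSiegel, §7 (7.2) p.44] -/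
theorem integral_normSq_add_taperProfile :
    ∫ t in (0:ℝ)..1, (‖taperProfile t‖ ^ 2 + ‖taperProfile' t‖ ^ 2) = 4 / 3 := by
  rw [intervalIntegral.integral_congr_Ioo_of_le zero_le_one
      (g := fun t => 0 * t ^ 4 + 0 * t ^ 3 + 1 * t ^ 2 + (-2) * t + 2) (fun t ht => by
      show ‖taperProfile t‖ ^ 2 + ‖taperProfile' t‖ ^ 2 = 0 * t ^ 4 + 0 * t ^ 3 + 1 * t ^ 2 + (-2) * t + 2
      rw [taperProfile_of_le_one ht.2.le, taperProfile'_of_lt_one ht.2, Complex.norm_real, Real.norm_eq_abs,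
        sq_abs, norm_neg, norm_one, one_pow]
      ring),
    integral_quartic]
  norm_num

/-- **`N₁(u_T) = √(4/3)`** (`KnifeEdge.inClassNorm`). [cite: Zhang2022LandauSiegel, §7 (7.2) p.44] -/
theorem inClassNorm_taperProfile : inClassNorm taperProfile taperProfile' = Real.sqrt (4 / 3) := by
  rw [inClassNorm, integral_normSq_add_taperProfile]

/-- `∫₁^θ (|v_J|² + |v_J′|²) = h³/3 + h`, `h = θ − 1`. [cite: Zhang2022LandauSiegel, §7 (7.2) p.44] -/
theorem integral_normSq_add_jumpProfile (hθ : 1 ≤ θ) :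
    ∫ t in (1:ℝ)..θ, (‖jumpProfile θ t‖ ^ 2 + ‖jumpProfile' θ t‖ ^ 2) = (θ - 1) ^ 3 / 3 + (θ - 1) := by
  rw [intervalIntegral.integral_congr_Ioo_of_le hθ
      (g := fun t => 0 * t ^ 4 + 0 * t ^ 3 + 1 * t ^ 2 + (-2 * θ) * t + (θ ^ 2 + 1)) (fun t ht => by
      show ‖jumpProfile θ t‖ ^ 2 + ‖jumpProfile' θ t‖ ^ 2
        = 0 * t ^ 4 + 0 * t ^ 3 + 1 * t ^ 2 + (-2 * θ) * t + (θ ^ 2 + 1)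
      rw [jumpProfile_of_mem ⟨ht.1, ht.2.le⟩, jumpProfile', if_pos ⟨ht.1, ht.2⟩, Complex.norm_real,
        Real.norm_eq_abs, sq_abs, norm_neg, norm_one, one_pow]
      ring),
    integral_quartic]
  ring

/-- **`N_θ(v_J) = √(h³/3 + h)`** (`KnifeEdge.overhangNorm`), `h = θ − 1`. [cite: Zhang2022LandauSiegel, §7 (7.2) p.44] -/
theorem overhangNorm_jumpProfile (hθ : 1 ≤ θ) :
    overhangNorm θ (jumpProfile θ) (jumpProfile' θ) = Real.sqrt ((θ - 1) ^ 3 / 3 + (θ - 1)) := by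
  rw [overhangNorm, integral_normSq_add_jumpProfile hθ]

/-- `∫₁^θ (|φ_θ|² + |φ_θ′|²) = h⁵/30 + h³/3`, `h = θ − 1`. [cite: Zhang2022LandauSiegel, §7 (7.2) p.44] -/
theorem integral_normSq_add_phiT (hθ : 1 ≤ θ) :
    ∫ t in (1:ℝ)..θ, (‖phiT θ t‖ ^ 2 + ‖phiT' θ t‖ ^ 2) = (θ - 1) ^ 5 / 30 + (θ - 1) ^ 3 / 3 := by
  rw [intervalIntegral.integral_congr_Ioo_of_le hθ
      (g := fun t => 1 * t ^ 4 + (-2 * (θ + 1)) * t ^ 3 + ((θ + 1) ^ 2 + 2 * θ + 4) * t ^ 2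
        + (-2 * θ * (θ + 1) - 4 * (θ + 1)) * t + (θ ^ 2 + (θ + 1) ^ 2)) (fun t ht => by
      show ‖phiT θ t‖ ^ 2 + ‖phiT' θ t‖ ^ 2
        = 1 * t ^ 4 + (-2 * (θ + 1)) * t ^ 3 + ((θ + 1) ^ 2 + 2 * θ + 4) * t ^ 2
          + (-2 * θ * (θ + 1) - 4 * (θ + 1)) * t + (θ ^ 2 + (θ + 1) ^ 2)
      rw [phiT_of_ge ht.1.le, phiT'_of_ge ht.1.le, Complex.norm_real, Complex.norm_real, Real.norm_eq_abs,
        Real.norm_eq_abs, sq_abs, sq_abs]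
      ring),
    integral_quartic]
  ring

/-- **`N_θ(φ_θ) = √(h⁵/30 + h³/3)`**, `h = θ − 1`. [cite: Zhang2022LandauSiegel, §7 (7.2) p.44] -/
theorem overhangNorm_phiT (hθ : 1 ≤ θ) :
    overhangNorm θ (phiT θ) (phiT' θ) = Real.sqrt ((θ - 1) ^ 5 / 30 + (θ - 1) ^ 3 / 3) := by
  rw [overhangNorm, integral_normSq_add_phiT hθ]

end Sizes

/-! ### Part 2 — the currency windows `C*`, `C_req` at the registered cells -/

section Currencies

/-! #### Elementary interval arithmetic for the two currency predicates
`RobustMargin`: `[(k + 2Cq)a < (c − Cm)² ∧ Cm ≤ c] ∨ [k + 2Cq < 0]`, `StrengthBelowReq`: `2Cq ≤ k ∧ (c + Cm)² ≤ (k − 2Cq)a`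
in the five atoms `a = 𝔅(u)`, `k = Re 𝔅_θ(v)`, `c = |c₀|`, `m = n₁n_θ`, `q = n_θ²`, from rational windows. -/

/-- `RobustMargin` from windows: `a ≤ aU`, `k ≤ kU`, `cL ≤ c`, `m ≤ mU`. [folklore] -/
private theorem robust_numeric {a k c m q C aU kU cL mU : ℝ} (ha0 : 0 ≤ a) (haU : a ≤ aU) (hkU : k ≤ kU)
    (hcL : cL ≤ c) (hmU : m ≤ mU) (hC : 0 ≤ C) (hk0 : 0 ≤ kU + 2 * C * q)
    (h1 : C * mU ≤ cL) (h2 : (kU + 2 * C * q) * aU < (cL - C * mU) ^ 2) :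
    ((k + 2 * C * q) * a < (c - C * m) ^ 2 ∧ C * m ≤ c) ∨ k + 2 * C * q < 0 := by
  left
  have hcm : cL - C * mU ≤ c - C * m := by nlinarith [mul_le_mul_of_nonneg_left hmU hC]
  have hcm0 : 0 ≤ cL - C * mU := by linarith
  refine ⟨?_, by nlinarith [mul_le_mul_of_nonneg_left hmU hC]⟩
  calc (k + 2 * C * q) * a ≤ (kU + 2 * C * q) * a := mul_le_mul_of_nonneg_right (by linarith) ha0
    _ ≤ (kU + 2 * C * q) * aU := mul_le_mul_of_nonneg_left haU hk0
    _ < (cL - C * mU) ^ 2 := h2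
    _ ≤ (c - C * m) ^ 2 := pow_le_pow_left₀ hcm0 hcm 2

/-- `¬ RobustMargin` from windows: `aL ≤ a`, `kL ≤ k`, `c ≤ cU`, `mL ≤ m`. [folklore] -/
private theorem not_robust_numeric {a k c m q C aL kL cU mL : ℝ} (haL : aL ≤ a) (haL0 : 0 ≤ aL)
    (hkL : kL ≤ k) (hcU : c ≤ cU) (hmL : mL ≤ m) (hC : 0 ≤ C) (hq : 0 ≤ q) (hkL0 : 0 ≤ kL)
    (h2 : (cU - C * mL) ^ 2 ≤ (kL + 2 * C * q) * aL) :
    ¬ (((k + 2 * C * q) * a < (c - C * m) ^ 2 ∧ C * m ≤ c) ∨ k + 2 * C * q < 0) := by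
  rintro (⟨hlt, hle⟩ | hneg)
  · have h0 : 0 ≤ c - C * m := by linarith
    have hup : c - C * m ≤ cU - C * mL := by nlinarith [mul_le_mul_of_nonneg_left hmL hC]
    have h3 : (c - C * m) ^ 2 ≤ (cU - C * mL) ^ 2 := pow_le_pow_left₀ h0 hup 2
    have h4 : (kL + 2 * C * q) * aL ≤ (k + 2 * C * q) * a :=
      mul_le_mul (by linarith) haL haL0 (by nlinarith [mul_nonneg hC hq])
    linarith
  · nlinarith [mul_nonneg hC hq]

/-- `StrengthBelowReq` from windows: `aL ≤ a`, `kL ≤ k`, `c ≤ cU`, `m ≤ mU`. [folklore] -/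
private theorem below_numeric {a k c m q C aL kL cU mU : ℝ} (haL : aL ≤ a) (haL0 : 0 ≤ aL) (hkL : kL ≤ k)
    (hc0 : 0 ≤ c) (hcU : c ≤ cU) (hm0 : 0 ≤ m) (hmU : m ≤ mU) (hC : 0 ≤ C) (h1 : 2 * C * q ≤ kL)
    (h2 : (cU + C * mU) ^ 2 ≤ (kL - 2 * C * q) * aL) :
    2 * C * q ≤ k ∧ (c + C * m) ^ 2 ≤ (k - 2 * C * q) * a := by
  refine ⟨by linarith, ?_⟩
  have hup : c + C * m ≤ cU + C * mU := by nlinarith [mul_le_mul_of_nonneg_left hmU hC]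
  have h0 : 0 ≤ c + C * m := by nlinarith [mul_nonneg hC hm0]
  calc (c + C * m) ^ 2 ≤ (cU + C * mU) ^ 2 := pow_le_pow_left₀ h0 hup 2
    _ ≤ (kL - 2 * C * q) * aL := h2
    _ ≤ (k - 2 * C * q) * a := mul_le_mul (by linarith) haL haL0 (by linarith)

/-- `¬ StrengthBelowReq` from windows: `a ≤ aU`, `k ≤ kU`, `cL ≤ c`, `mL ≤ m`. [folklore] -/
private theorem not_below_numeric {a k c m q C aU kU cL mL : ℝ} (ha0 : 0 ≤ a) (haU : a ≤ aU) (hkU : k ≤ kU)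
    (hcL : cL ≤ c) (hmL : mL ≤ m) (hC : 0 ≤ C) (hcL0 : 0 ≤ cL + C * mL) (hkq : 0 ≤ kU - 2 * C * q)
    (h2 : (kU - 2 * C * q) * aU < (cL + C * mL) ^ 2) :
    ¬ (2 * C * q ≤ k ∧ (c + C * m) ^ 2 ≤ (k - 2 * C * q) * a) := by
  rintro ⟨h1, h3⟩
  have hlo : cL + C * mL ≤ c + C * m := by nlinarith [mul_le_mul_of_nonneg_left hmL hC]
  have h4 : (cL + C * mL) ^ 2 ≤ (c + C * m) ^ 2 := pow_le_pow_left₀ hcL0 hlo 2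
  have h5 : (k - 2 * C * q) * a ≤ (kU - 2 * C * q) * aU :=
    mul_le_mul (by linarith) haU ha0 hkq
  linarith

/-- A norm window from a window on the squared norm. [folklore] -/
private theorem norm_window {z : ℂ} {K lo hi : ℝ} (hK : ‖z‖ ^ 2 = K) (hlo : 0 ≤ lo) (hhi : 0 ≤ hi)
    (h1 : lo ^ 2 ≤ K) (h2 : K ≤ hi ^ 2) : lo ≤ ‖z‖ ∧ ‖z‖ ≤ hi :=
  ⟨(pow_le_pow_iff_left₀ hlo (norm_nonneg z) two_ne_zero).1 (by rw [hK]; exact h1),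
    (pow_le_pow_iff_left₀ (norm_nonneg z) hhi two_ne_zero).1 (by rw [hK]; exact h2)⟩

/-- A square-root window. [folklore] -/
private theorem sqrt_window {r lo hi : ℝ} (hhi : 0 ≤ hi) (h1 : lo ^ 2 ≤ r) (h2 : r ≤ hi ^ 2) :
    lo ≤ Real.sqrt r ∧ Real.sqrt r ≤ hi :=
  ⟨Real.le_sqrt_of_sq_le h1, (Real.sqrt_le_left hhi).2 h2⟩

/-- Twenty-digit `π`: `π²`, `π⁴` windows. [folklore] -/
private theorem pi_pow_bounds20 :
    3.14159265358979323846 ^ 2 < π ^ 2 ∧ π ^ 2 < 3.14159265358979323847 ^ 2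
      ∧ 3.14159265358979323846 ^ 4 < π ^ 4 ∧ π ^ 4 < 3.14159265358979323847 ^ 4 := by
  have h1 := Real.pi_gt_d20
  have h2 := Real.pi_lt_d20
  have h0 : (0:ℝ) ≤ 3.14159265358979323846 := by norm_num
  have hπ : 0 ≤ π := Real.pi_pos.le
  exact ⟨pow_lt_pow_left₀ h1 h0 (by norm_num), pow_lt_pow_left₀ h2 hπ (by norm_num),
    pow_lt_pow_left₀ h1 h0 (by norm_num), pow_lt_pow_left₀ h2 hπ (by norm_num)⟩

/-- `𝔅(u_T) = 8/π + 52π/3 ∈ (57.00075175, 57.00075176)`. [cite: Zhang2022LandauSiegel, §7 (7.2) p.44] -/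
private theorem taper_a_window : 57.00075175 < 8 / π + 52 / 3 * π ∧ 8 / π + 52 / 3 * π < 57.00075176 := by
  have hπ := Real.pi_gt_d20
  have hπ' := Real.pi_lt_d20
  have hπ0 : 0 < π := Real.pi_pos
  constructor
  · rw [div_add' _ _ _ hπ0.ne', lt_div_iff₀ hπ0]
    nlinarith [mul_pos hπ0 (sub_pos.2 hπ')]
  · rw [div_add' _ _ _ hπ0.ne', div_lt_iff₀ hπ0]
    nlinarith [mul_pos hπ0 (sub_pos.2 hπ)]

/-- **`C*(u_T ⊕ v_J, θ = 2) ∈ (1.95, 1.96)`**: `RobustMargin 2 1.95` holds and `RobustMargin 2 1.96` fails for the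
registered jump design (bed-7 printed `C* = 1.95`; atoms `a = k₀ = 8/π + 52π/3`, `|c₀| = 6π√(1+π²)`, `n_θ² = 4/3`,
`n₁n_θ = 4/3`). [cite: Zhang2022LandauSiegel, §7 Prop 7.1 (7.2) p.44] -/
theorem robustMargin_window_taper_jump_two :
    RobustMargin 2 1.95 taperProfile taperProfile' (jumpProfile 2) (jumpProfile' 2)
      ∧ ¬ RobustMargin 2 1.96 taperProfile taperProfile' (jumpProfile 2) (jumpProfile' 2) := by
  have hθ : (1:ℝ) ≤ 2 := by norm_num
  have hπl := Real.pi_gt_d20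
  have hπu := Real.pi_lt_d20
  have hπ0 : 0 < π := Real.pi_pos
  obtain ⟨h2l, h2u, h4l, h4u⟩ := pi_pow_bounds20
  obtain ⟨haL, haU⟩ := taper_a_window
  have hk : 57.000751 ≤ 8 * (2 - 1) / π + 52 / 3 * π * (2 - 1) ^ 3
      ∧ 8 * (2 - 1) / π + 52 / 3 * π * (2 - 1) ^ 3 ≤ 57.000752 := by
    constructor
    · rw [div_add' _ _ _ hπ0.ne', le_div_iff₀ hπ0]
      nlinarith [mul_pos hπ0 (sub_pos.2 hπu)]
    · rw [div_add' _ _ _ hπ0.ne', div_le_iff₀ hπ0]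
      nlinarith [mul_pos hπ0 (sub_pos.2 hπl)]
  obtain ⟨hcL, hcU⟩ := norm_window (norm_sq_tailCoupling_taper_jumpProfile hθ) (lo := 62.145257)
    (hi := 62.145258) (by norm_num) (by norm_num)
    (by norm_num at h2l h4l ⊢; nlinarith [h2l, h4l]) (by norm_num at h2u h4u ⊢; nlinarith [h2u, h4u])
  obtain ⟨hmL, hmU⟩ := sqrt_window (r := 4 / 3 * ((2 - 1) ^ 3 / 3 + (2 - 1))) (lo := 1.333333)
    (hi := 1.333334) (by norm_num) (by norm_num) (by norm_num)
  unfold RobustMargin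
  rw [topDiagForm_jumpProfile_re hθ, overhangNorm_jumpProfile hθ, inClassNorm_taperProfile,
    mainTermForm_taperProfile, Real.sq_sqrt (by norm_num), mul_assoc (1.95:ℝ), mul_assoc (1.96:ℝ),
    ← Real.sqrt_mul (by norm_num)]
  exact ⟨robust_numeric (by positivity) haU.le hk.2 hcL hmU (by norm_num) (by norm_num) (by norm_num)
      (by norm_num),
    not_robust_numeric haL.le (by norm_num) hk.1 hcU hmL (by norm_num) (by norm_num) (by norm_num)
      (by norm_num)⟩

/-- **`C*(u_T ⊕ v_J, θ = 3) ∈ (22.46, 22.47)`** (bed-7 printed `22.5`; `n_θ² = 14/3`, `n₁n_θ = √(56/9)`).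
[cite: Zhang2022LandauSiegel, §7 Prop 7.1 (7.2) p.44] -/
theorem robustMargin_window_taper_jump_three :
    RobustMargin 3 22.46 taperProfile taperProfile' (jumpProfile 3) (jumpProfile' 3)
      ∧ ¬ RobustMargin 3 22.47 taperProfile taperProfile' (jumpProfile 3) (jumpProfile' 3) := by
  have hθ : (1:ℝ) ≤ 3 := by norm_num
  have hπl := Real.pi_gt_d20
  have hπu := Real.pi_lt_d20
  have hπ0 : 0 < π := Real.pi_pos
  obtain ⟨h2l, h2u, h4l, h4u⟩ := pi_pow_bounds20
  obtain ⟨haL, haU⟩ := taper_a_window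
  have hk : 440.727139 ≤ 8 * (3 - 1) / π + 52 / 3 * π * (3 - 1) ^ 3
      ∧ 8 * (3 - 1) / π + 52 / 3 * π * (3 - 1) ^ 3 ≤ 440.72714 := by
    constructor
    · rw [div_add' _ _ _ hπ0.ne', le_div_iff₀ hπ0]
      nlinarith [mul_pos hπ0 (sub_pos.2 hπu)]
    · rw [div_add' _ _ _ hπ0.ne', div_le_iff₀ hπ0]
      nlinarith [mul_pos hπ0 (sub_pos.2 hπl)]
  obtain ⟨hcL, hcU⟩ := norm_window (norm_sq_tailCoupling_taper_jumpProfile hθ) (lo := 248.58103)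
    (hi := 248.581031) (by norm_num) (by norm_num)
    (by norm_num at h2l h4l ⊢; nlinarith [h2l, h4l]) (by norm_num at h2u h4u ⊢; nlinarith [h2u, h4u])
  obtain ⟨hmL, hmU⟩ := sqrt_window (r := 4 / 3 * ((3 - 1) ^ 3 / 3 + (3 - 1))) (lo := 2.494438)
    (hi := 2.494439) (by norm_num) (by norm_num) (by norm_num)
  unfold RobustMargin
  rw [topDiagForm_jumpProfile_re hθ, overhangNorm_jumpProfile hθ, inClassNorm_taperProfile,
    mainTermForm_taperProfile, Real.sq_sqrt (by norm_num), mul_assoc (22.46:ℝ), mul_assoc (22.47:ℝ),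
    ← Real.sqrt_mul (by norm_num)]
  exact ⟨robust_numeric (by positivity) haU.le hk.2 hcL hmU (by norm_num) (by norm_num) (by norm_num)
      (by norm_num),
    not_robust_numeric haL.le (by norm_num) hk.1 hcU hmL (by norm_num) (by norm_num) (by norm_num)
      (by norm_num)⟩

/-- **`C*(u_T ⊕ φ_3, θ = 3) ∈ (9.17, 9.18)`** (bed-7 printed `9.17`; arch: `k₀ = 64/(3π) + 1408π/15`,
`|c₀| = 16π√(1+π²)`, `n_θ² = 56/15`). [cite: Zhang2022LandauSiegel, §7 Prop 7.1 (7.2) p.44] -/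
theorem robustMargin_window_taper_phiT_three :
    RobustMargin 3 9.17 taperProfile taperProfile' (phiT 3) (phiT' 3)
      ∧ ¬ RobustMargin 3 9.18 taperProfile taperProfile' (phiT 3) (phiT' 3) := by
  have hθ : (1:ℝ) ≤ 3 := by norm_num
  have hπl := Real.pi_gt_d20
  have hπu := Real.pi_lt_d20
  have hπ0 : 0 < π := Real.pi_pos
  have h3π : (3:ℝ) * π ≠ 0 := by positivity
  obtain ⟨h2l, h2u, h4l, h4u⟩ := pi_pow_bounds20
  obtain ⟨haL, haU⟩ := taper_a_window
  have hk : 301.681441 ≤ 8 * (3 - 1) ^ 3 / (3 * π) + 44 / 15 * π * (3 - 1) ^ 5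
      ∧ 8 * (3 - 1) ^ 3 / (3 * π) + 44 / 15 * π * (3 - 1) ^ 5 ≤ 301.681442 := by
    constructor
    · rw [div_add' _ _ _ h3π, le_div_iff₀ (by positivity)]
      nlinarith [mul_pos hπ0 (sub_pos.2 hπu)]
    · rw [div_add' _ _ _ h3π, div_le_iff₀ (by positivity)]
      nlinarith [mul_pos hπ0 (sub_pos.2 hπl)]
  obtain ⟨hcL, hcU⟩ := norm_window (norm_sq_tailCoupling_taper_phiT hθ) (lo := 165.720686)
    (hi := 165.720687) (by norm_num) (by norm_num)
    (by norm_num at h2l h4l ⊢; nlinarith [h2l, h4l]) (by norm_num at h2u h4u ⊢; nlinarith [h2u, h4u])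
  obtain ⟨hmL, hmU⟩ := sqrt_window (r := 4 / 3 * ((3 - 1) ^ 5 / 30 + (3 - 1) ^ 3 / 3)) (lo := 2.231093)
    (hi := 2.231094) (by norm_num) (by norm_num) (by norm_num)
  unfold RobustMargin
  rw [topDiagForm_phiT_re hθ, overhangNorm_phiT hθ, inClassNorm_taperProfile,
    mainTermForm_taperProfile, Real.sq_sqrt (by norm_num), mul_assoc (9.17:ℝ), mul_assoc (9.18:ℝ),
    ← Real.sqrt_mul (by norm_num)]
  exact ⟨robust_numeric (by positivity) haU.le hk.2 hcL hmU (by norm_num) (by norm_num) (by norm_num)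
      (by norm_num),
    not_robust_numeric haL.le (by norm_num) hk.1 hcU hmL (by norm_num) (by norm_num) (by norm_num)
      (by norm_num)⟩

/-- **`C_req(u_T ⊕ v_J, θ = 3/2) ∈ (2.43, 2.44)`**: `StrengthBelowReq (3/2) 2.43` holds and `… 2.44` fails
(bed-7 printed `2.44`; `n_θ² = 13/24`). [cite: Zhang2022LandauSiegel, §7 Prop 7.1 (7.2) p.44] -/
theorem strengthBelowReq_window_taper_jump_three_halves :
    StrengthBelowReq (3/2) 2.43 taperProfile taperProfile' (jumpProfile (3/2)) (jumpProfile' (3/2))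
      ∧ ¬ StrengthBelowReq (3/2) 2.44 taperProfile taperProfile' (jumpProfile (3/2)) (jumpProfile' (3/2)) := by
  have hθ : (1:ℝ) ≤ 3/2 := by norm_num
  have hπl := Real.pi_gt_d20
  have hπu := Real.pi_lt_d20
  have hπ0 : 0 < π := Real.pi_pos
  obtain ⟨h2l, h2u, h4l, h4u⟩ := pi_pow_bounds20
  obtain ⟨haL, haU⟩ := taper_a_window
  have hk : 8.080023 ≤ 8 * (3/2 - 1) / π + 52 / 3 * π * (3/2 - 1) ^ 3
      ∧ 8 * (3/2 - 1) / π + 52 / 3 * π * (3/2 - 1) ^ 3 ≤ 8.080024 := by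
    constructor
    · rw [div_add' _ _ _ hπ0.ne', le_div_iff₀ hπ0]
      nlinarith [mul_pos hπ0 (sub_pos.2 hπu)]
    · rw [div_add' _ _ _ hπ0.ne', div_le_iff₀ hπ0]
      nlinarith [mul_pos hπ0 (sub_pos.2 hπl)]
  obtain ⟨hcL, hcU⟩ := norm_window (norm_sq_tailCoupling_taper_jumpProfile hθ) (lo := 15.536314)
    (hi := 15.536315) (by norm_num) (by norm_num)
    (by norm_num at h2l h4l ⊢; nlinarith [h2l, h4l]) (by norm_num at h2u h4u ⊢; nlinarith [h2u, h4u])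
  obtain ⟨hmL, hmU⟩ := sqrt_window (r := 4 / 3 * ((3/2 - 1) ^ 3 / 3 + (3/2 - 1))) (lo := 0.849836)
    (hi := 0.849837) (by norm_num) (by norm_num) (by norm_num)
  have hm0 : 0 ≤ Real.sqrt (4 / 3 * ((3/2 - 1) ^ 3 / 3 + (3/2 - 1))) := Real.sqrt_nonneg _
  unfold StrengthBelowReq
  rw [topDiagForm_jumpProfile_re hθ, overhangNorm_jumpProfile hθ, inClassNorm_taperProfile,
    mainTermForm_taperProfile, Real.sq_sqrt (by norm_num), mul_assoc (2.43:ℝ), mul_assoc (2.44:ℝ),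
    ← Real.sqrt_mul (by norm_num)]
  exact ⟨below_numeric haL.le (by norm_num) hk.1 (norm_nonneg _) hcU hm0 hmU (by norm_num) (by norm_num)
      (by norm_num),
    not_below_numeric (by positivity) haU.le hk.2 hcL hmL (by norm_num) (by norm_num) (by norm_num)
      (by norm_num)⟩

/-- **`C_req(u_T ⊕ v_J, θ = 5/4) ∈ (2.03, 2.04)`** (bed-7 printed `2.03`; `n_θ² = 49/192`).
[cite: Zhang2022LandauSiegel, §7 Prop 7.1 (7.2) p.44] -/
theorem strengthBelowReq_window_taper_jump_five_quarters :
    StrengthBelowReq (5/4) 2.03 taperProfile taperProfile' (jumpProfile (5/4)) (jumpProfile' (5/4))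
      ∧ ¬ StrengthBelowReq (5/4) 2.04 taperProfile taperProfile' (jumpProfile (5/4)) (jumpProfile' (5/4)) := by
  have hθ : (1:ℝ) ≤ 5/4 := by norm_num
  have hπl := Real.pi_gt_d20
  have hπu := Real.pi_lt_d20
  have hπ0 : 0 < π := Real.pi_pos
  obtain ⟨h2l, h2u, h4l, h4u⟩ := pi_pow_bounds20
  obtain ⟨haL, haU⟩ := taper_a_window
  have hk : 1.487467 ≤ 8 * (5/4 - 1) / π + 52 / 3 * π * (5/4 - 1) ^ 3
      ∧ 8 * (5/4 - 1) / π + 52 / 3 * π * (5/4 - 1) ^ 3 ≤ 1.487468 := by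
    constructor
    · rw [div_add' _ _ _ hπ0.ne', le_div_iff₀ hπ0]
      nlinarith [mul_pos hπ0 (sub_pos.2 hπu)]
    · rw [div_add' _ _ _ hπ0.ne', div_le_iff₀ hπ0]
      nlinarith [mul_pos hπ0 (sub_pos.2 hπl)]
  obtain ⟨hcL, hcU⟩ := norm_window (norm_sq_tailCoupling_taper_jumpProfile hθ) (lo := 3.884078)
    (hi := 3.884079) (by norm_num) (by norm_num)
    (by norm_num at h2l h4l ⊢; nlinarith [h2l, h4l]) (by norm_num at h2u h4u ⊢; nlinarith [h2u, h4u])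
  obtain ⟨hmL, hmU⟩ := sqrt_window (r := 4 / 3 * ((5/4 - 1) ^ 3 / 3 + (5/4 - 1))) (lo := 0.583333)
    (hi := 0.583334) (by norm_num) (by norm_num) (by norm_num)
  have hm0 : 0 ≤ Real.sqrt (4 / 3 * ((5/4 - 1) ^ 3 / 3 + (5/4 - 1))) := Real.sqrt_nonneg _
  unfold StrengthBelowReq
  rw [topDiagForm_jumpProfile_re hθ, overhangNorm_jumpProfile hθ, inClassNorm_taperProfile,
    mainTermForm_taperProfile, Real.sq_sqrt (by norm_num), mul_assoc (2.03:ℝ), mul_assoc (2.04:ℝ),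
    ← Real.sqrt_mul (by norm_num)]
  exact ⟨below_numeric haL.le (by norm_num) hk.1 (norm_nonneg _) hcU hm0 hmU (by norm_num) (by norm_num)
      (by norm_num),
    not_below_numeric (by positivity) haU.le hk.2 hcL hmL (by norm_num) (by norm_num) (by norm_num)
      (by norm_num)⟩

/-- **`C_req(u_T ⊕ φ_2, θ = 2) ∈ (2.01, 2.02)`** (bed-7 printed `2.01`; arch: `k₀ = 8/(3π) + 44π/15`,
`|c₀| = 2π√(1+π²)`, `n_θ² = 11/30`). [cite: Zhang2022LandauSiegel, §7 Prop 7.1 (7.2) p.44] -/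
theorem strengthBelowReq_window_taper_phiT_two :
    StrengthBelowReq 2 2.01 taperProfile taperProfile' (phiT 2) (phiT' 2)
      ∧ ¬ StrengthBelowReq 2 2.02 taperProfile taperProfile' (phiT 2) (phiT' 2) := by
  have hθ : (1:ℝ) ≤ 2 := by norm_num
  have hπl := Real.pi_gt_d20
  have hπu := Real.pi_lt_d20
  have hπ0 : 0 < π := Real.pi_pos
  have h3π : (3:ℝ) * π ≠ 0 := by positivity
  obtain ⟨h2l, h2u, h4l, h4u⟩ := pi_pow_bounds20
  obtain ⟨haL, haU⟩ := taper_a_window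
  have hk : 10.064164 ≤ 8 * (2 - 1) ^ 3 / (3 * π) + 44 / 15 * π * (2 - 1) ^ 5
      ∧ 8 * (2 - 1) ^ 3 / (3 * π) + 44 / 15 * π * (2 - 1) ^ 5 ≤ 10.064165 := by
    constructor
    · rw [div_add' _ _ _ h3π, le_div_iff₀ (by positivity)]
      nlinarith [mul_pos hπ0 (sub_pos.2 hπu)]
    · rw [div_add' _ _ _ h3π, div_le_iff₀ (by positivity)]
      nlinarith [mul_pos hπ0 (sub_pos.2 hπl)]
  obtain ⟨hcL, hcU⟩ := norm_window (norm_sq_tailCoupling_taper_phiT hθ) (lo := 20.715085)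
    (hi := 20.715086) (by norm_num) (by norm_num)
    (by norm_num at h2l h4l ⊢; nlinarith [h2l, h4l]) (by norm_num at h2u h4u ⊢; nlinarith [h2u, h4u])
  obtain ⟨hmL, hmU⟩ := sqrt_window (r := 4 / 3 * ((2 - 1) ^ 5 / 30 + (2 - 1) ^ 3 / 3)) (lo := 0.699205)
    (hi := 0.699206) (by norm_num) (by norm_num) (by norm_num)
  have hm0 : 0 ≤ Real.sqrt (4 / 3 * ((2 - 1) ^ 5 / 30 + (2 - 1) ^ 3 / 3)) := Real.sqrt_nonneg _
  unfold StrengthBelowReq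
  rw [topDiagForm_phiT_re hθ, overhangNorm_phiT hθ, inClassNorm_taperProfile,
    mainTermForm_taperProfile, Real.sq_sqrt (by norm_num), mul_assoc (2.01:ℝ), mul_assoc (2.02:ℝ),
    ← Real.sqrt_mul (by norm_num)]
  exact ⟨below_numeric haL.le (by norm_num) hk.1 (norm_nonneg _) hcU hm0 hmU (by norm_num) (by norm_num)
      (by norm_num),
    not_below_numeric (by positivity) haU.le hk.2 hcL hmL (by norm_num) (by norm_num) (by norm_num)
      (by norm_num)⟩

/-- **`C_req(u_T ⊕ φ_{3/2}, θ = 3/2) ∈ (2.52, 2.53)`** (bed-7 printed `2.52`; `n_θ² = 41/960`).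
[cite: Zhang2022LandauSiegel, §7 Prop 7.1 (7.2) p.44] -/
theorem strengthBelowReq_window_taper_phiT_three_halves :
    StrengthBelowReq (3/2) 2.52 taperProfile taperProfile' (phiT (3/2)) (phiT' (3/2))
      ∧ ¬ StrengthBelowReq (3/2) 2.53 taperProfile taperProfile' (phiT (3/2)) (phiT' (3/2)) := by
  have hθ : (1:ℝ) ≤ 3/2 := by norm_num
  have hπl := Real.pi_gt_d20
  have hπu := Real.pi_lt_d20
  have hπ0 : 0 < π := Real.pi_pos
  have h3π : (3:ℝ) * π ≠ 0 := by positivity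
  obtain ⟨h2l, h2u, h4l, h4u⟩ := pi_pow_bounds20
  obtain ⟨haL, haU⟩ := taper_a_window
  have hk : 0.394082 ≤ 8 * (3/2 - 1) ^ 3 / (3 * π) + 44 / 15 * π * (3/2 - 1) ^ 5
      ∧ 8 * (3/2 - 1) ^ 3 / (3 * π) + 44 / 15 * π * (3/2 - 1) ^ 5 ≤ 0.394083 := by
    constructor
    · rw [div_add' _ _ _ h3π, le_div_iff₀ (by positivity)]
      nlinarith [mul_pos hπ0 (sub_pos.2 hπu)]
    · rw [div_add' _ _ _ h3π, div_le_iff₀ (by positivity)]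
      nlinarith [mul_pos hπ0 (sub_pos.2 hπl)]
  obtain ⟨hcL, hcU⟩ := norm_window (norm_sq_tailCoupling_taper_phiT hθ) (lo := 2.589385)
    (hi := 2.589386) (by norm_num) (by norm_num)
    (by norm_num at h2l h4l ⊢; nlinarith [h2l, h4l]) (by norm_num at h2u h4u ⊢; nlinarith [h2u, h4u])
  obtain ⟨hmL, hmU⟩ := sqrt_window (r := 4 / 3 * ((3/2 - 1) ^ 5 / 30 + (3/2 - 1) ^ 3 / 3)) (lo := 0.23863)
    (hi := 0.238631) (by norm_num) (by norm_num) (by norm_num)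
  have hm0 : 0 ≤ Real.sqrt (4 / 3 * ((3/2 - 1) ^ 5 / 30 + (3/2 - 1) ^ 3 / 3)) := Real.sqrt_nonneg _
  unfold StrengthBelowReq
  rw [topDiagForm_phiT_re hθ, overhangNorm_phiT hθ, inClassNorm_taperProfile,
    mainTermForm_taperProfile, Real.sq_sqrt (by norm_num), mul_assoc (2.52:ℝ), mul_assoc (2.53:ℝ),
    ← Real.sqrt_mul (by norm_num)]
  exact ⟨below_numeric haL.le (by norm_num) hk.1 (norm_nonneg _) hcU hm0 hmU (by norm_num) (by norm_num)
      (by norm_num),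
    not_below_numeric (by positivity) haU.le hk.2 hcL hmL (by norm_num) (by norm_num) (by norm_num)
      (by norm_num)⟩

/-- **`C_req(u_T ⊕ φ_{5/4}, θ = 5/4) ∈ (1.75, 1.76)`** (bed-7 printed `1.75`; `n_θ² = 161/30720`).
[cite: Zhang2022LandauSiegel, §7 Prop 7.1 (7.2) p.44] -/
theorem strengthBelowReq_window_taper_phiT_five_quarters :
    StrengthBelowReq (5/4) 1.75 taperProfile taperProfile' (phiT (5/4)) (phiT' (5/4))
      ∧ ¬ StrengthBelowReq (5/4) 1.76 taperProfile taperProfile' (phiT (5/4)) (phiT' (5/4)) := by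
  have hθ : (1:ℝ) ≤ 5/4 := by norm_num
  have hπl := Real.pi_gt_d20
  have hπu := Real.pi_lt_d20
  have hπ0 : 0 < π := Real.pi_pos
  have h3π : (3:ℝ) * π ≠ 0 := by positivity
  obtain ⟨h2l, h2u, h4l, h4u⟩ := pi_pow_bounds20
  obtain ⟨haL, haU⟩ := taper_a_window
  have hk : 0.022262 ≤ 8 * (5/4 - 1) ^ 3 / (3 * π) + 44 / 15 * π * (5/4 - 1) ^ 5
      ∧ 8 * (5/4 - 1) ^ 3 / (3 * π) + 44 / 15 * π * (5/4 - 1) ^ 5 ≤ 0.022263 := by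
    constructor
    · rw [div_add' _ _ _ h3π, le_div_iff₀ (by positivity)]
      nlinarith [mul_pos hπ0 (sub_pos.2 hπu)]
    · rw [div_add' _ _ _ h3π, div_le_iff₀ (by positivity)]
      nlinarith [mul_pos hπ0 (sub_pos.2 hπl)]
  obtain ⟨hcL, hcU⟩ := norm_window (norm_sq_tailCoupling_taper_phiT hθ) (lo := 0.323673)
    (hi := 0.323674) (by norm_num) (by norm_num)
    (by norm_num at h2l h4l ⊢; nlinarith [h2l, h4l]) (by norm_num at h2u h4u ⊢; nlinarith [h2u, h4u])
  obtain ⟨hmL, hmU⟩ := sqrt_window (r := 4 / 3 * ((5/4 - 1) ^ 5 / 30 + (5/4 - 1) ^ 3 / 3)) (lo := 0.083593)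
    (hi := 0.083594) (by norm_num) (by norm_num) (by norm_num)
  have hm0 : 0 ≤ Real.sqrt (4 / 3 * ((5/4 - 1) ^ 5 / 30 + (5/4 - 1) ^ 3 / 3)) := Real.sqrt_nonneg _
  unfold StrengthBelowReq
  rw [topDiagForm_phiT_re hθ, overhangNorm_phiT hθ, inClassNorm_taperProfile,
    mainTermForm_taperProfile, Real.sq_sqrt (by norm_num), mul_assoc (1.75:ℝ), mul_assoc (1.76:ℝ),
    ← Real.sqrt_mul (by norm_num)]
  exact ⟨below_numeric haL.le (by norm_num) hk.1 (norm_nonneg _) hcU hm0 hmU (by norm_num) (by norm_num)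
      (by norm_num),
    not_below_numeric (by positivity) haU.le hk.2 hcL hmL (by norm_num) (by norm_num) (by norm_num)
      (by norm_num)⟩

end Currencies

end Literature.NumberTheory.LFunctions.Zhang2022.Repair.Bed
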